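import Summits.QuantumFields.YangMills.Theorems.FiniteRankMirrorCrossPeelingPairs
import Summits.QuantumFields.YangMills.Theorems.BalabanLadderNTReferencePackageScales
import Summits.QuantumFields.YangMills.Theorems.FiniteRankMirrorDefectPeelingGlue
import HarnessLib

/-!
# Route `UniversalDetector`, LINE g9-3 «Hölder-gradient peeling» — preparatory lemmas

Ideator seat ym-idea-8 (generation 9, lens «dual»).  Helper lemmas for the glue item
`Summit.QuantumFields.YangMills.Theses.UniversalDetector.TightPeelingGlue` (the split of the deciding crux
`PlaneTightScheme`, stmt-QuantumFields-23250, into one-point response laws + two-cube peeling):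

* `abs_torusCov_plane_sub_le_of_expMoments` — the INCREMENT pair bound: for a plaquette `P_{q₁}(z₁)` obeying the singleton
  exponential response moment (RM₁) at radius `R` and the lattice increment `P_{q₂}(z₂) − P_{q₂}(z₂ + u)` (`|u j| ≤ n`,
  `2n ≤ R`) obeying the Hölder-gradient response moment (RMH, gain `(R/n)^γ`), on cubes `2R+6` apart,
  `|Cov_T(P_{q₁}(z₁), P_{q₂}(z₂) − P_{q₂}(z₂+u))| ≤ 4 √(e^B e^{B₂}) C₁ C₂ / (R⁸ (R/n)^γ)` (two-cube peeling, `x²/2 ≤ eˣ`);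
* `halving_geometry` — centring a pair `(0, z)` of the odd torus `2L+1` by the translation `m = z/2` (coordinatewise):
  both cubes of radius `N` around `−m` and `z − m` sit in the coordinate window and are `2N+6` apart along the long
  coordinate of `z`;
* small norm facts for `siteToE` (coordinate vs Euclidean norm, lattice vectors have norm `≥ 1`).

Refs: Georgii, *Gibbs Measures and Phase Transitions* (2011) Def. 1.23 (consistency/properness of specifications);
Simon 1993 §III (conditioning inequalities) [folklore peeling]; the g9-1 files `…FiniteRankMirrorPeeling`,
`…FiniteRankMirrorCrossPeelingPairs`.
-/

set_option autoImplicit false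

noncomputable section

open MeasureTheory Filter Topology
open Literature.MathematicalPhysics.QuantumFieldTheory Literature.MathematicalPhysics.QuantumLattice
open Literature.Probability.LatticeModels
open Summit.QuantumFields.YangMills.Cruxes.OSLegsFromFemtoAndGap.DlrCollarTransfer
open Summit.QuantumFields.YangMills.Cruxes.UVSeamRec.ResponseVariance (supp_plane_window)
open Summit.QuantumFields.YangMills.Cruxes.NT.MarkovMirror (torusE_sq_le_of_expMoment)
open Summit.QuantumFields.YangMills.Cruxes.NT.Reference (continuous_kerE)
open Summit.QuantumFields.YangMills.Cruxes.NT.CumulantPolarisation (torusE_sub)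
open Summit.QuantumFields.YangMills.Cruxes.FiniteRankMirrorPeeling (twoCube_peel cube_window_of_abs_le)

namespace Summit.QuantumFields.YangMills.Cruxes.UniversalDetectorTightPeeling

/-! ## §1 Lattice-vector norm facts -/

section Norms

variable {d : ℕ}

/-- A nonzero lattice vector has Euclidean norm at least `1`. [folklore] -/
theorem one_le_norm_siteToE {y : Fin d → ℤ} (hy : y ≠ 0) : 1 ≤ ‖siteToE y‖ := by
  obtain ⟨i, hi⟩ := Function.ne_iff.1 hy
  have h1 : (1 : ℤ) ≤ |y i| := Int.one_le_abs hi
  calc (1 : ℝ) ≤ |(y i : ℝ)| := by exact_mod_cast h1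
    _ ≤ ‖siteToE y‖ := by
      have h := PiLp.norm_apply_le (siteToE y) i
      rwa [Real.norm_eq_abs] at h

/-- If every coordinate of a vector of `ℤ⁴` is at most `M` in absolute value, its Euclidean norm is at most `2M`. [folklore] -/
theorem norm_siteToE_le_two_mul {M : ℝ} (hM : 0 ≤ M) {z : Fin 4 → ℤ} (hz : ∀ j, |(z j : ℝ)| ≤ M) :
    ‖siteToE z‖ ≤ 2 * M := by
  have hsq : ‖siteToE z‖ ^ 2 = ∑ j, ‖siteToE z j‖ ^ 2 := PiLp.norm_sq_eq_of_L2 _ _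
  have hle : ∑ j : Fin 4, ‖siteToE z j‖ ^ 2 ≤ ∑ _j : Fin 4, M ^ 2 :=
    Finset.sum_le_sum fun j _ => by
      rw [siteToE_apply, Real.norm_eq_abs]
      exact pow_le_pow_left₀ (abs_nonneg _) (hz j) 2
  have h4 : ∑ _j : Fin 4, M ^ 2 = (2 * M) ^ 2 := by simp; ring
  rw [h4, ← hsq] at hle
  exact (sq_le_sq₀ (norm_nonneg _) (by positivity)).1 hle

/-- The norm of a scaled lattice vector: `‖a • siteToE z‖ = a ‖siteToE z‖` for `a ≥ 0`. [folklore] -/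
theorem norm_smul_siteToE {a : ℝ} (ha : 0 ≤ a) (z : Fin d → ℤ) : ‖a • siteToE z‖ = a * ‖siteToE z‖ := by
  rw [norm_smul, Real.norm_of_nonneg ha]

end Norms

/-! ## §2 Centring a pair on the odd torus -/

/-- **Halving geometry.**  On the odd torus `2L+1`, for `z` in the box with a long coordinate `|z j₀| ≥ 2N+6` and
`2N+12 ≤ L`, the translate `m := z/2` (coordinatewise) puts the cubes of radius `N` (side `2N+3`, corner `· − (N+1)`)
around `−m` and `z − m` inside the coordinate window `[−L+2, L−3]`, and `2N+6` apart along `j₀`. [folklore] -/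
theorem halving_geometry {L N : ℕ} {z : Fin 4 → ℤ} (hz : ∀ j, -(L : ℤ) ≤ z j ∧ z j ≤ L) (hL : 2 * N + 12 ≤ L)
    {j₀ : Fin 4} (hj₀ : 2 * (N : ℤ) + 6 ≤ |z j₀|) :
    (∀ j, |(-(fun k => z k / 2)) j| + (N : ℤ) + 6 ≤ (L : ℤ)) ∧
    (∀ j, |(z - fun k => z k / 2) j| + (N : ℤ) + 6 ≤ (L : ℤ)) ∧
    (∃ j, (-(fun k => z k / 2)) j + 2 * (N : ℤ) + 6 ≤ (z - fun k => z k / 2) j ∨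
      (z - fun k => z k / 2) j + 2 * (N : ℤ) + 6 ≤ (-(fun k => z k / 2)) j) := by
  have hL' : 2 * (N : ℤ) + 12 ≤ (L : ℤ) := by exact_mod_cast hL
  refine ⟨fun j => ?_, fun j => ?_, ⟨j₀, ?_⟩⟩
  · have h := hz j
    simp only [Pi.neg_apply, abs_neg]
    rcases le_or_gt 0 (z j / 2) with h0 | h0
    · rw [abs_of_nonneg h0]; omega
    · rw [abs_of_neg h0]; omega
  · have h := hz j
    simp only [Pi.sub_apply]
    rcases le_or_gt 0 (z j - z j / 2) with h0 | h0
    · rw [abs_of_nonneg h0]; omega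
    · rw [abs_of_neg h0]; omega
  · simp only [Pi.neg_apply, Pi.sub_apply]
    rcases le_abs'.1 hj₀ with h | h
    · right; omega
    · left; omega

/-! ## §3 The increment pair bound in the letters of (RM₁) and (RMH) -/

section Pair

variable (G : Type) [Group G] [TopologicalSpace G] [IsTopologicalGroup G] [CompactSpace G]
  [MeasurableSpace G] [BorelSpace G] (r : LatticeRep G)

/-- `√(2e^B/λ²) = √(2e^B)/λ` for `λ > 0`. [folklore] -/
theorem sqrt_two_mul_exp_div_sq (B : ℝ) {lam : ℝ} (hlam : 0 < lam) :
    Real.sqrt (2 * Real.exp B / lam ^ 2) = Real.sqrt (2 * Real.exp B) / lam := by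
  rw [Real.sqrt_div' _ (sq_nonneg lam), Real.sqrt_sq hlam.le]

omit [BorelSpace G] in
/-- The support window of the lattice increment `P_q(x) − P_q(x+u)`, `|u j| ≤ n ≤ R`, inside the cube of radius `R`
around `x`. [folklore] -/
theorem supp_plane_sub_window (R n : ℕ) (hn : n ≤ R) (q : Fin 4 × Fin 4) (x u : Fin 4 → ℤ) (hu : ∀ j, |u j| ≤ (n : ℤ)) :
    ∀ e ∈ (originPlaquetteSupport q.1 q.2).image (fun e => (e.1 - -x, e.2)) ∪
        (originPlaquetteSupport q.1 q.2).image (fun e => (e.1 - -(x + u), e.2)), ∀ j,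
      (fun k => x k - ((R : ℤ) + 1)) j ≤ e.1 j ∧ e.1 j ≤ (fun k => x k - ((R : ℤ) + 1)) j + (2 * R + 3 : ℕ) := by
  intro e he j
  have hn' : (n : ℤ) ≤ R := by exact_mod_cast hn
  rcases Finset.mem_union.1 he with he | he
  · exact supp_plane_window R q x e he j
  · have h := near_of_mem_supp_plane he j
    have huj := abs_le.1 (hu j)
    simp only [Pi.add_apply] at h
    dsimp only
    push_cast
    constructor <;> linarith [h.1, h.2, huj.1, huj.2]

/-- **Increment pair bound.**  Plaquette `P_{q₁}(z₁)` with the singleton exponential response moment (RM₁) at radius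
`R ≥ 1`, lattice increment `P_{q₂}(z₂) − P_{q₂}(z₂+u)` (`|u j| ≤ n ≤ R`) with the Hölder-gradient response moment (RMH) at
the same radius (rate `λ₂ > 0`, in applications `λ₂ = R⁴ (R/n)^γ / C₂`), cubes inside the window and `2R+6` apart:
`|Cov_T(P_{q₁}(z₁), P_{q₂}(z₂) − P_{q₂}(z₂+u))| ≤ 2 · (√(2e^B) C₁/R⁴) · (√(2e^{B₂})/λ₂)` (two-cube peeling). [folklore] -/
theorem abs_torusCov_plane_sub_le_of_expMoments {β : ℝ} {L R n : ℕ} (hR : 1 ≤ R) (hn : n ≤ R) (q₁ q₂ : Fin 4 × Fin 4)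
    (z₁ z₂ u : Fin 4 → ℤ) (hu : ∀ j, |u j| ≤ (n : ℤ))
    (hz₁ : ∀ j, |z₁ j| + (R : ℤ) + 6 ≤ (L : ℤ)) (hz₂ : ∀ j, |z₂ j| + (R : ℤ) + 6 ≤ (L : ℤ))
    (hsep : ∃ j, z₁ j + 2 * (R : ℤ) + 6 ≤ z₂ j ∨ z₂ j + 2 * (R : ℤ) + 6 ≤ z₁ j)
    {C₁ B B₂ lam₂ p₁ : ℝ} (hC₁ : 0 < C₁) (hlam₂ : 0 < lam₂)
    (h₁ : torusE G r β L (fun U => Real.exp ((R : ℝ) ^ 4 / C₁ *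
        |kerE G r β (fun k => z₁ k - ((R : ℤ) + 1)) (2 * R + 3) U (plane G r q₁ z₁) - p₁|)) ≤ Real.exp B)
    (h₂ : torusE G r β L (fun U => Real.exp (lam₂ *
        |kerE G r β (fun k => z₂ k - ((R : ℤ) + 1)) (2 * R + 3) U (fun V => plane G r q₂ z₂ V - plane G r q₂ (z₂ + u) V)|))
        ≤ Real.exp B₂) :
    |torusE G r β L (fun U => plane G r q₁ z₁ U * (plane G r q₂ z₂ U - plane G r q₂ (z₂ + u) U)) -
        torusE G r β L (plane G r q₁ z₁) * torusE G r β L (fun U => plane G r q₂ z₂ U - plane G r q₂ (z₂ + u) U)| ≤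
      2 * (Real.sqrt (2 * Real.exp B) * C₁ / (R : ℝ) ^ 4) * (Real.sqrt (2 * Real.exp B₂) / lam₂) := by
  obtain ⟨CP, hCP⟩ := exists_abs_plane_le (G := G) r
  have hsep' : ∃ j, (fun k => z₁ k - ((R : ℤ) + 1)) j + ((2 * R + 3 : ℕ) : ℤ) + 3 ≤ (fun k => z₂ k - ((R : ℤ) + 1)) j ∨
      (fun k => z₂ k - ((R : ℤ) + 1)) j + ((2 * R + 3 : ℕ) : ℤ) + 3 ≤ (fun k => z₁ k - ((R : ℤ) + 1)) j := by
    obtain ⟨j, hj⟩ := hsep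
    refine ⟨j, ?_⟩
    dsimp only
    push_cast
    rcases hj with h | h
    · left; linarith
    · right; linarith
  have hF₂c : Continuous fun V => plane G r q₂ z₂ V - plane G r q₂ (z₂ + u) V :=
    (continuous_plane r q₂ z₂).sub (continuous_plane r q₂ (z₂ + u))
  have hF₂M : ∀ V, |plane G r q₂ z₂ V - plane G r q₂ (z₂ + u) V| ≤ CP + CP := fun V =>
    (abs_sub _ _).trans (add_le_add (hCP q₂ z₂ V) (hCP q₂ (z₂ + u) V))
  have hF₂S := Summit.QuantumFields.YangMills.Cruxes.FiniteRankMirrorDefectPeeling.isCylinder_sub G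
    (isCylinder_plane r q₂ z₂) (isCylinder_plane r q₂ (z₂ + u))
  have hpeel := twoCube_peel G r β L (fun k => z₁ k - ((R : ℤ) + 1)) (fun k => z₂ k - ((R : ℤ) + 1))
    (2 * R + 3) (2 * R + 3) (cube_window_of_abs_le hz₁) (cube_window_of_abs_le hz₂) hsep'
    (continuous_plane r q₁ z₁) hF₂c (hCP q₁ z₁) hF₂M
    (isCylinder_plane r q₁ z₁) hF₂S (supp_plane_window R q₁ z₁) (supp_plane_sub_window R n hn q₂ z₂ u hu)
    p₁ 0
  simp only [sub_zero] at hpeel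
  -- mean-square responses from the exponential moments
  have hlam₁ : 0 < (R : ℝ) ^ 4 / C₁ := by positivity
  have hk₁ : Continuous fun U => kerE G r β (fun k => z₁ k - ((R : ℤ) + 1)) (2 * R + 3) U (plane G r q₁ z₁) - p₁ :=
    (continuous_kerE G r β _ (2 * R + 3) (continuous_plane r q₁ z₁) (hCP q₁ z₁)).sub continuous_const
  have hk₂ : Continuous fun U => kerE G r β (fun k => z₂ k - ((R : ℤ) + 1)) (2 * R + 3) U
      (fun V => plane G r q₂ z₂ V - plane G r q₂ (z₂ + u) V) :=
    continuous_kerE G r β _ (2 * R + 3) hF₂c hF₂M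
  have hms₁ := torusE_sq_le_of_expMoment G r β L hk₁ hlam₁ h₁
  have hms₂ : torusE G r β L (fun U => (kerE G r β (fun k => z₂ k - ((R : ℤ) + 1)) (2 * R + 3) U
      (fun V => plane G r q₂ z₂ V - plane G r q₂ (z₂ + u) V)) ^ 2) ≤ 2 * Real.exp B₂ / lam₂ ^ 2 := by
    have h := torusE_sq_le_of_expMoment G r β L hk₂ hlam₂ h₂
    simpa using h
  have hs₁ := Real.sqrt_le_sqrt hms₁
  have hs₂ := Real.sqrt_le_sqrt hms₂
  rw [sqrt_two_mul_exp_div_sq B hlam₁] at hs₁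
  rw [sqrt_two_mul_exp_div_sq B₂ hlam₂] at hs₂
  have e1 : Real.sqrt (2 * Real.exp B) / ((R : ℝ) ^ 4 / C₁) = Real.sqrt (2 * Real.exp B) * C₁ / (R : ℝ) ^ 4 := by
    field_simp
  rw [e1] at hs₁
  calc _ ≤ _ := hpeel
    _ ≤ 2 * (Real.sqrt (2 * Real.exp B) * C₁ / (R : ℝ) ^ 4) * (Real.sqrt (2 * Real.exp B₂) / lam₂) := by
        rw [mul_assoc, mul_assoc]
        exact mul_le_mul_of_nonneg_left (mul_le_mul hs₁ hs₂ (Real.sqrt_nonneg _) (by positivity)) (by norm_num)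

/-- Linearity of the torus covariance in the second slot: `Cov_T(F, A) − Cov_T(F, B) = Cov_T(F, A − B)`. [folklore] -/
theorem torusCov_sub_right (β : ℝ) (L : ℕ) {F A B : LGConfig 4 G → ℝ} (hF : Continuous F) (hA : Continuous A)
    (hB : Continuous B) :
    (torusE G r β L (fun U => F U * A U) - torusE G r β L F * torusE G r β L A) -
        (torusE G r β L (fun U => F U * B U) - torusE G r β L F * torusE G r β L B) =
      torusE G r β L (fun U => F U * (A U - B U)) - torusE G r β L F * torusE G r β L (fun U => A U - B U) := by
  have e1 : (fun U => F U * (A U - B U)) = fun U => F U * A U - F U * B U := by funext U; ring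
  rw [e1, torusE_sub G r β L (F := fun U => F U * A U) (H := fun U => F U * B U) (hF.mul hA) (hF.mul hB),
    torusE_sub G r β L hA hB]
  ring

end Pair

end Summit.QuantumFields.YangMills.Cruxes.UniversalDetectorTightPeeling
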